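import Summits.QuantumFields.YangMills.Theorems.SandwichVariancePinchingCeilingDefect

/-!
# Route `SandwichVariancePinching` — crux `QuadraticVarianceCeiling` (stmt-QuantumFields-28259):
# toolkit II for the smooth whitened CEILING — the Stein remainder `R = ∂_{Hx+b}A − q` has variance `O(δ²)·rV`

For a centred sandwiched `C²` potential (`0 ≤ δ < 1`), symmetric `H`, `b`, `q = xᵀHx + bᵀx`:
* `phi_sq_le` — for every `v`, the centred `C¹` function `φ_v := ∂_vA − v·x` (`= v·∇W`, `W = A − |x|²/2`) has
  `∫ φ_v² e^{−A} ≤ (1−δ)⁻¹ δ² |v|² Z`: first-order Brascamp–Lieb (`bl_raw_of_sandwich`) with the constant gradient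
  bound `|∇φ_v|² = |(D²A − 1)v|² ≤ δ²|v|²` (`defect_sq_le`) and `∫φ_v e^{−A} = 0` (score identity + centring);
* `remainder_variance_le` — for `R := ∂_{Hx+b}A − q`:
  `(∫R²e^{−A})Z − (∫R e^{−A})² ≤ (1−δ)⁻¹·(2δ²(∫|Hx|²e^{−A} + |b|²Z) + 2(1−δ)⁻¹δ² tr(H²) Z)·Z`,
  from `bl_raw_of_sandwich` and `|∇R|² ≤ 2|(D²A−1)(Hx+b)|² + 2Σ_j φ_{He_j}²`.

HONEST SCOPE.  Free-hands work of the LEAD seat of crux stmt-QuantumFields-22884 (cell ym-idea-1) toward crux 28259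
of planner ym-idea-3's draft-by-design sub-line; helper lemmas only — nothing here proves the ceiling,
`QuadraticCovarianceComparison` (26240), the `LogConcaveChart` thesis, rung R2a or any summit statement; the
Yang–Mills mass gap is NOT proved by any of this.
-/

noncomputable section

namespace Summit.QuantumFields.YangMills.Theorems.SandwichVariancePinching

open MeasureTheory Real Filter Topology
open Literature.Probability.Distributions (coordGradient coordHessian)
open Summit.QuantumFields.YangMills.Cruxes.TransportCovarianceTransfer

variable {n : ℕ}

/-- `∂_i(∂_vA − v·x) = D²A(x)(e_i, v) − v_i`. [folklore] -/
theorem fderiv_phi {A : (Fin n → ℝ) → ℝ} (hA : ContDiff ℝ 2 A) (v x : Fin n → ℝ) (i : Fin n) :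
    fderiv ℝ (fun y : Fin n → ℝ => fderiv ℝ A y v - v ⬝ᵥ y) x (Pi.single i 1) =
      fderiv ℝ (fderiv ℝ A) x (Pi.single i 1) v - v i := by
  obtain ⟨L, hL, hLv⟩ := hasFDerivAt_fderiv_affine hA 0 v x
  simp only [Matrix.zero_mulVec, zero_add] at hL hLv
  obtain ⟨Λ, hΛ⟩ := exists_clm_dotProduct v
  have hΛd : HasFDerivAt (fun y : Fin n → ℝ => v ⬝ᵥ y) Λ x := by
    have : (fun y : Fin n → ℝ => v ⬝ᵥ y) = Λ := by funext y; rw [hΛ]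
    rw [this]; exact Λ.hasFDerivAt
  have h : HasFDerivAt (fun y : Fin n → ℝ => fderiv ℝ A y v - v ⬝ᵥ y) (L - Λ) x := hL.sub hΛd
  rw [h.fderiv, sub_apply, hLv, hΛ, dotProduct_single, mul_one]
  simp

/-- `∂_vA − v·x` is `C¹`. [folklore] -/
theorem contDiff_phi {A : (Fin n → ℝ) → ℝ} (hA : ContDiff ℝ 2 A) (v : Fin n → ℝ) :
    ContDiff ℝ 1 fun y : Fin n → ℝ => fderiv ℝ A y v - v ⬝ᵥ y := by
  have h1 : ContDiff ℝ 1 fun y : Fin n → ℝ => fderiv ℝ A y ((0 : Matrix (Fin n) (Fin n) ℝ).mulVec y + v) :=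
    contDiff_fderiv_affine hA 0 _
  simp only [Matrix.zero_mulVec, zero_add] at h1
  obtain ⟨Λ, hΛ⟩ := exists_clm_dotProduct v
  have hl : ContDiff ℝ 1 (fun y : Fin n → ℝ => v ⬝ᵥ y) := by
    have : (fun y : Fin n → ℝ => v ⬝ᵥ y) = Λ := by funext y; rw [hΛ]
    rw [this]; exact Λ.contDiff
  exact h1.sub hl

/-- **`∫ (∂_vA − v·x)² e^{−A} ≤ (1−δ)⁻¹ δ² |v|² ∫e^{−A}`** for a centred sandwiched `C²` potential. [folklore] -/
theorem phi_sq_le {A : (Fin n → ℝ) → ℝ} (hA : ContDiff ℝ 2 A) {δ : ℝ} (hδ : 0 ≤ δ) (hδ1 : δ < 1)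
    (hsw : ∀ x h : Fin n → ℝ, (1 - δ) * (h ⬝ᵥ h) ≤ A (x + h) + A (x - h) - 2 * A x ∧
      A (x + h) + A (x - h) - 2 * A x ≤ (1 + δ) * (h ⬝ᵥ h))
    (hcent : ∀ i : Fin n, ∫ x, x i * exp (-A x) = 0) (v : Fin n → ℝ) :
    ∫ x, (fderiv ℝ A x v - v ⬝ᵥ x) ^ 2 * exp (-A x) ≤ (1 - δ)⁻¹ * (δ ^ 2 * (v ⬝ᵥ v)) * ∫ x, exp (-A x) := by
  have hAc : Continuous A := hA.continuous
  obtain ⟨C₀, κ, _, hκ, hlb⟩ := exists_quadratic_lower_of_sandwich hAc hδ1 hsw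
  have hZint : Integrable fun x => exp (-A x) := by
    have := integrable_mul_exp_neg_of_growth hAc continuous_const hκ (by norm_num : 0 ≤ 8) hlb
      (w := fun _ => (1:ℝ)) (D := 1) (fun x => by simp)
    simpa using this
  have hZ : 0 < ∫ x, exp (-A x) := integral_exp_pos hZint
  set φ : (Fin n → ℝ) → ℝ := fun y => fderiv ℝ A y v - v ⬝ᵥ y with hφdef
  have hφc1 : ContDiff ℝ 1 φ := contDiff_phi hA v
  -- growth of `φ` and its partials
  obtain ⟨Kv, hKv0, hKv⟩ := exists_abs_fderiv_le_of_sandwich hA hδ hsw v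
  have hφb : ∀ x, |φ x| ≤ (Kv + ∑ i, |v i|) * (1 + ‖x‖) ^ 3 := fun x => by
    have h1 := hKv x
    have h2 := abs_dotProduct_le_growth v x
    have hr : (1:ℝ) ≤ 1 + ‖x‖ := by linarith [norm_nonneg x]
    have hs : 0 ≤ ∑ i, |v i| := Finset.sum_nonneg fun i _ => abs_nonneg _
    calc |φ x| ≤ |fderiv ℝ A x v| + |v ⬝ᵥ x| := abs_sub _ _
      _ ≤ Kv * (1 + ‖x‖) ^ 2 + (∑ i, |v i|) * (1 + ‖x‖) ^ 1 := add_le_add h1 h2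
      _ ≤ Kv * (1 + ‖x‖) ^ 3 + (∑ i, |v i|) * (1 + ‖x‖) ^ 3 := by
          nlinarith [pow_le_pow_right₀ hr (by norm_num : 2 ≤ 3), pow_le_pow_right₀ hr (by norm_num : 1 ≤ 3)]
      _ = (Kv + ∑ i, |v i|) * (1 + ‖x‖) ^ 3 := by ring
  have hφ'b : ∀ x (i : Fin n), |fderiv ℝ φ x (Pi.single i 1)| ≤
      ((1 + δ) / 2 * ((n : ℝ) + (n : ℝ) * ‖v‖ ^ 2) + ‖v‖) * (1 + ‖x‖) ^ 2 := by
    intro x i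
    rw [show φ = fun y => fderiv ℝ A y v - v ⬝ᵥ y from rfl, fderiv_phi hA v x i]
    have h1 := abs_fderiv_fderiv_le_norm hA hsw hδ x (Pi.single i 1) v
    have hn1 : ‖(Pi.single i (1:ℝ) : Fin n → ℝ)‖ = 1 := by rw [Pi.norm_single, norm_one]
    rw [hn1] at h1
    have h2 : |v i| ≤ ‖v‖ := by simpa [Real.norm_eq_abs] using norm_le_pi_norm v i
    have h4 : (1:ℝ) ≤ (1 + ‖x‖) ^ 2 := by nlinarith [norm_nonneg x]
    calc |fderiv ℝ (fderiv ℝ A) x (Pi.single i 1) v - v i|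
        ≤ (1 + δ) / 2 * ((n : ℝ) * 1 ^ 2 + (n : ℝ) * ‖v‖ ^ 2) + ‖v‖ := (abs_sub _ _).trans (add_le_add h1 h2)
      _ ≤ ((1 + δ) / 2 * ((n : ℝ) + (n : ℝ) * ‖v‖ ^ 2) + ‖v‖) * (1 + ‖x‖) ^ 2 := by
          rw [one_pow, mul_one]
          exact le_mul_of_one_le_right (by positivity) h4
  -- mean zero
  have hφ0 : ∫ x, φ x * exp (-A x) = 0 := by
    have h1 := integral_mul_fderiv_affine_mul_exp_neg hA hδ hδ1 hsw 0 v
      (F := fun _ => (1:ℝ)) contDiff_const (DF := 1) (DF' := 0)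
      (fun x => by rw [abs_one, one_mul]; exact one_le_pow₀ (by linarith [norm_nonneg x]))
      (fun x j => by simp)
    simp only [one_mul, fderiv_fun_const, Pi.zero_apply, zero_apply, zero_add, Matrix.zero_mulVec,
      Matrix.trace_zero, zero_mul, mul_one] at h1
    have hIa : Integrable fun x => fderiv ℝ A x v * exp (-A x) :=
      integrable_mul_exp_neg_of_growth hAc (continuous_fderiv_apply_of_contDiff hA _) hκ (by norm_num) hlb hKv
    have hIl : Integrable fun x => (v ⬝ᵥ x) * exp (-A x) :=
      integrable_mul_exp_neg_of_growth hAc (continuous_const.dotProduct continuous_id) hκ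
        (by norm_num : 1 ≤ 8) hlb (abs_dotProduct_le_growth v)
    have e : (fun x => φ x * exp (-A x)) = fun x => fderiv ℝ A x v * exp (-A x) - (v ⬝ᵥ x) * exp (-A x) := by
      funext x; simp only [hφdef]; ring
    rw [e, integral_sub hIa hIl, integral_dotProduct_mul_exp_neg_eq_zero hAc hδ1 hsw hcent v, sub_zero]
    simpa using h1
  -- Brascamp–Lieb
  have hbl := bl_raw_of_sandwich hA hδ1 hsw hφc1 hφb hφ'b
  rw [hφ0] at hbl
  have hg : ∀ x, coordGradient φ x ⬝ᵥ coordGradient φ x ≤ δ ^ 2 * (v ⬝ᵥ v) := by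
    intro x
    have hd := defect_sq_le hA hδ hsw x v
    have e : coordGradient φ x = fun i => fderiv ℝ (fderiv ℝ A) x (Pi.single i 1) v - v i := by
      funext i; exact fderiv_phi hA v x i
    rw [e]; exact hd
  have hgI : Integrable fun x => (coordGradient φ x ⬝ᵥ coordGradient φ x) * exp (-A x) := by
    refine integrable_mul_exp_neg_of_growth hAc
      ((Literature.Probability.Distributions.continuous_coordGradient hφc1).dotProduct
        (Literature.Probability.Distributions.continuous_coordGradient hφc1)) hκ (by norm_num : 0 ≤ 8) hlb
      (D := δ ^ 2 * (v ⬝ᵥ v)) fun x => ?_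
    rw [pow_zero, mul_one, abs_of_nonneg (by simpa using dotProduct_self_star_nonneg (coordGradient φ x))]
    exact hg x
  have hmono : ∫ x, (coordGradient φ x ⬝ᵥ coordGradient φ x) * exp (-A x) ≤
      ∫ x, (δ ^ 2 * (v ⬝ᵥ v)) * exp (-A x) :=
    integral_mono hgI (hZint.const_mul _) fun x => mul_le_mul_of_nonneg_right (hg x) (exp_pos _).le
  rw [integral_const_mul] at hmono
  have hinv : 0 ≤ (1 - δ)⁻¹ := inv_nonneg.mpr (by linarith)
  have : (∫ x, φ x ^ 2 * exp (-A x)) * (∫ x, exp (-A x)) ≤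
      ((1 - δ)⁻¹ * (δ ^ 2 * (v ⬝ᵥ v)) * ∫ x, exp (-A x)) * ∫ x, exp (-A x) := by
    have h2 := mul_le_mul_of_nonneg_left hmono hinv
    nlinarith [h2, hbl]
  exact le_of_mul_le_mul_right this hZ

/-- **VARIANCE OF THE STEIN REMAINDER** `R := ∂_{Hx+b}A − q`:
`(∫R²e^{−A})Z − (∫Re^{−A})² ≤ (1−δ)⁻¹(2δ²(∫|Hx|²e^{−A} + |b|²Z) + 2(1−δ)⁻¹δ² tr(H²)Z)·Z`. [folklore] -/
theorem remainder_variance_le {A : (Fin n → ℝ) → ℝ} (hA : ContDiff ℝ 2 A) {δ : ℝ} (hδ : 0 ≤ δ)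
    (hδ1 : δ < 1)
    (hsw : ∀ x h : Fin n → ℝ, (1 - δ) * (h ⬝ᵥ h) ≤ A (x + h) + A (x - h) - 2 * A x ∧
      A (x + h) + A (x - h) - 2 * A x ≤ (1 + δ) * (h ⬝ᵥ h))
    (hcent : ∀ i : Fin n, ∫ x, x i * exp (-A x) = 0) {H : Matrix (Fin n) (Fin n) ℝ} (hH : H.IsSymm)
    (b : Fin n → ℝ) :
    (∫ x, (fderiv ℝ A x (H.mulVec x + b) - (x ⬝ᵥ H.mulVec x + b ⬝ᵥ x)) ^ 2 * exp (-A x)) * (∫ x, exp (-A x)) -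
        (∫ x, (fderiv ℝ A x (H.mulVec x + b) - (x ⬝ᵥ H.mulVec x + b ⬝ᵥ x)) * exp (-A x)) ^ 2 ≤
      (1 - δ)⁻¹ * (2 * δ ^ 2 * ((∫ x, (H.mulVec x ⬝ᵥ H.mulVec x) * exp (-A x)) + (b ⬝ᵥ b) * ∫ x, exp (-A x)) +
        2 * ((1 - δ)⁻¹ * (δ ^ 2 * (H * H).trace) * ∫ x, exp (-A x))) * ∫ x, exp (-A x) := by
  have hAc : Continuous A := hA.continuous
  obtain ⟨C₀, κ, _, hκ, hlb⟩ := exists_quadratic_lower_of_sandwich hAc hδ1 hsw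
  have hZint : Integrable fun x => exp (-A x) := by
    have := integrable_mul_exp_neg_of_growth hAc continuous_const hκ (by norm_num : 0 ≤ 8) hlb
      (w := fun _ => (1:ℝ)) (D := 1) (fun x => by simp)
    simpa using this
  have hZ : 0 < ∫ x, exp (-A x) := integral_exp_pos hZint
  set Z : ℝ := ∫ x, exp (-A x) with hZdef
  set q : (Fin n → ℝ) → ℝ := fun x => x ⬝ᵥ H.mulVec x + b ⬝ᵥ x with hqdef
  have hqc1 : ContDiff ℝ 1 q := contDiff_quadObs H b
  have hqd : ∀ x v, fderiv ℝ q x v = ((2:ℝ) • H.mulVec x + b) ⬝ᵥ v := fun x v => fderiv_quadObs hH b x v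
  obtain ⟨Dq, Dq', hDq0, hDq'0, hqb, hq'b⟩ := quadObs_growth hH b
  set R : (Fin n → ℝ) → ℝ := fun x => fderiv ℝ A x (H.mulVec x + b) - q x with hRdef
  have hRc1 : ContDiff ℝ 1 R := (contDiff_fderiv_affine hA H b).sub hqc1
  obtain ⟨D₁, hD₁0, hD₁⟩ := exists_abs_fderiv_affine_le hA hδ hsw H b
  have hRb : ∀ x, |R x| ≤ (D₁ + Dq) * (1 + ‖x‖) ^ 3 := fun x => by
    calc |R x| ≤ |fderiv ℝ A x (H.mulVec x + b)| + |q x| := abs_sub _ _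
      _ ≤ D₁ * (1 + ‖x‖) ^ 3 + Dq * (1 + ‖x‖) ^ 3 := add_le_add (hD₁ x) (hqb x)
      _ = (D₁ + Dq) * (1 + ‖x‖) ^ 3 := by ring
  -- partials of `R`
  have hRd : ∀ x (j : Fin n), fderiv ℝ R x (Pi.single j 1) =
      (fderiv ℝ (fderiv ℝ A) x (Pi.single j 1) (H.mulVec x + b) - (H.mulVec x + b) j) +
        (fderiv ℝ A x (H.mulVec (Pi.single j 1)) - H.mulVec (Pi.single j 1) ⬝ᵥ x) := by
    intro x j
    obtain ⟨L, hL, hLv⟩ := hasFDerivAt_fderiv_affine hA H b x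
    have hqd' : HasFDerivAt q (fderiv ℝ q x) x := (hqc1.differentiable one_ne_zero x).hasFDerivAt
    have hR : HasFDerivAt R (L - fderiv ℝ q x) x := hL.sub hqd'
    rw [hR.fderiv, sub_apply, hLv, hqd]
    have e1 : H.mulVec (Pi.single j 1) ⬝ᵥ x = (H.mulVec x) j := by
      rw [show (H.mulVec x) j = H j ⬝ᵥ x from rfl, Matrix.mulVec_single_one]
      simp only [dotProduct, Matrix.col_apply]
      exact Finset.sum_congr rfl fun i _ => by rw [hH.apply i j]
    rw [e1]
    simp only [dotProduct_single, mul_one, Pi.add_apply, Pi.smul_apply, smul_eq_mul]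
    ring
  have hR'b : ∃ D : ℝ, ∀ x (j : Fin n), |fderiv ℝ R x (Pi.single j 1)| ≤ D * (1 + ‖x‖) ^ 2 := by
    have h := fun j : Fin n => exists_abs_fderiv_fderiv_affine_le hA hδ hsw H b (Pi.single j 1)
    choose Dj hDj0 hDj using h
    refine ⟨∑ j, Dj j + Dq', fun x j => ?_⟩
    have hLfd : fderiv ℝ R x (Pi.single j 1) = fderiv ℝ (fun y => fderiv ℝ A y (H.mulVec y + b)) x (Pi.single j 1)
        - fderiv ℝ q x (Pi.single j 1) := by
      have hqd' : HasFDerivAt q (fderiv ℝ q x) x := (hqc1.differentiable one_ne_zero x).hasFDerivAt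
      obtain ⟨L, hL, hLv⟩ := hasFDerivAt_fderiv_affine hA H b x
      have hR : HasFDerivAt R (L - fderiv ℝ q x) x := hL.sub hqd'
      rw [hR.fderiv, hL.fderiv, sub_apply]
    rw [hLfd]
    have h1 := hDj j x
    have h2 := hq'b x j
    have h3 : Dj j ≤ ∑ j, Dj j := Finset.single_le_sum (fun i _ => hDj0 i) (Finset.mem_univ j)
    calc |fderiv ℝ (fun y => fderiv ℝ A y (H.mulVec y + b)) x (Pi.single j 1) - fderiv ℝ q x (Pi.single j 1)|
        ≤ Dj j * (1 + ‖x‖) ^ 2 + Dq' * (1 + ‖x‖) ^ 2 := (abs_sub _ _).trans (add_le_add h1 h2)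
      _ ≤ (∑ j, Dj j + Dq') * (1 + ‖x‖) ^ 2 := by nlinarith [sq_nonneg (1 + ‖x‖)]
  obtain ⟨DR, hDR⟩ := hR'b
  have hblR := bl_raw_of_sandwich hA hδ1 hsw hRc1 hRb hDR
  -- the pointwise gradient bound
  set φ : Fin n → (Fin n → ℝ) → ℝ := fun j x => fderiv ℝ A x (H.mulVec (Pi.single j 1)) -
    H.mulVec (Pi.single j 1) ⬝ᵥ x with hφdef
  have hgradR : ∀ x, coordGradient R x ⬝ᵥ coordGradient R x ≤
      2 * (δ ^ 2 * ((H.mulVec x + b) ⬝ᵥ (H.mulVec x + b))) + 2 * ∑ j, φ j x ^ 2 := by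
    intro x
    have hd := defect_sq_le hA hδ hsw x (H.mulVec x + b)
    simp only [dotProduct] at hd ⊢
    simp only [coordGradient, hRd, hφdef]
    have hpt : ∀ a c : ℝ, (a + c) * (a + c) ≤ 2 * (a * a) + 2 * (c * c) := fun a c => by
      nlinarith [sq_nonneg (a - c)]
    calc ∑ j, (fderiv ℝ (fderiv ℝ A) x (Pi.single j 1) (H.mulVec x + b) - (H.mulVec x + b) j +
          (fderiv ℝ A x (H.mulVec (Pi.single j 1)) - H.mulVec (Pi.single j 1) ⬝ᵥ x)) *
          (fderiv ℝ (fderiv ℝ A) x (Pi.single j 1) (H.mulVec x + b) - (H.mulVec x + b) j +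
          (fderiv ℝ A x (H.mulVec (Pi.single j 1)) - H.mulVec (Pi.single j 1) ⬝ᵥ x))
        ≤ ∑ j, (2 * ((fderiv ℝ (fderiv ℝ A) x (Pi.single j 1) (H.mulVec x + b) - (H.mulVec x + b) j) *
            (fderiv ℝ (fderiv ℝ A) x (Pi.single j 1) (H.mulVec x + b) - (H.mulVec x + b) j)) +
            2 * ((fderiv ℝ A x (H.mulVec (Pi.single j 1)) - H.mulVec (Pi.single j 1) ⬝ᵥ x) *
            (fderiv ℝ A x (H.mulVec (Pi.single j 1)) - H.mulVec (Pi.single j 1) ⬝ᵥ x))) :=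
          Finset.sum_le_sum fun j _ => hpt _ _
      _ = 2 * ∑ j, (fderiv ℝ (fderiv ℝ A) x (Pi.single j 1) (H.mulVec x + b) - (H.mulVec x + b) j) *
            (fderiv ℝ (fderiv ℝ A) x (Pi.single j 1) (H.mulVec x + b) - (H.mulVec x + b) j) +
          2 * ∑ j, (fderiv ℝ A x (H.mulVec (Pi.single j 1)) - H.mulVec (Pi.single j 1) ⬝ᵥ x) ^ 2 := by
          rw [Finset.sum_add_distrib, Finset.mul_sum, Finset.mul_sum]
          congr 1
          exact Finset.sum_congr rfl fun j _ => by ring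
      _ ≤ 2 * (δ ^ 2 * ∑ j, (H.mulVec x + b) j * (H.mulVec x + b) j) +
          2 * ∑ j, (fderiv ℝ A x (H.mulVec (Pi.single j 1)) - H.mulVec (Pi.single j 1) ⬝ᵥ x) ^ 2 := by
          linarith [hd]
  -- integrate
  have hφ2 : ∀ j, ∫ x, φ j x ^ 2 * exp (-A x) ≤
      (1 - δ)⁻¹ * (δ ^ 2 * (H.mulVec (Pi.single j 1) ⬝ᵥ H.mulVec (Pi.single j 1))) * Z := fun j =>
    phi_sq_le hA hδ hδ1 hsw hcent (H.mulVec (Pi.single j 1))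
  have hHcols : ∑ j, H.mulVec (Pi.single j 1) ⬝ᵥ H.mulVec (Pi.single j 1) = (H * H).trace := by
    rw [trace_mul_self_of_isSymm hH]
    simp only [Matrix.mulVec_single_one, dotProduct, Matrix.col_apply, sq]
    rw [Finset.sum_comm]
  have hIφ2 : ∀ j, Integrable fun x => φ j x ^ 2 * exp (-A x) := fun j => by
    obtain ⟨Kv, _, hKv⟩ := exists_abs_fderiv_le_of_sandwich hA hδ hsw (H.mulVec (Pi.single j 1))
    have hb1 : ∀ x, |φ j x| ≤ (Kv + ∑ i, |H.mulVec (Pi.single j 1) i|) * (1 + ‖x‖) ^ 3 := fun x => by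
      have h1 := hKv x
      have h2 := abs_dotProduct_le_growth (H.mulVec (Pi.single j 1)) x
      have hr : (1:ℝ) ≤ 1 + ‖x‖ := by linarith [norm_nonneg x]
      have hs : 0 ≤ ∑ i, |H.mulVec (Pi.single j 1) i| := Finset.sum_nonneg fun i _ => abs_nonneg _
      calc |φ j x| ≤ |fderiv ℝ A x (H.mulVec (Pi.single j 1))| + |H.mulVec (Pi.single j 1) ⬝ᵥ x| := abs_sub _ _
        _ ≤ Kv * (1 + ‖x‖) ^ 2 + (∑ i, |H.mulVec (Pi.single j 1) i|) * (1 + ‖x‖) ^ 1 := add_le_add h1 h2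
        _ ≤ Kv * (1 + ‖x‖) ^ 3 + (∑ i, |H.mulVec (Pi.single j 1) i|) * (1 + ‖x‖) ^ 3 := by
            nlinarith [pow_le_pow_right₀ hr (by norm_num : 2 ≤ 3), pow_le_pow_right₀ hr (by norm_num : 1 ≤ 3)]
        _ = (Kv + ∑ i, |H.mulVec (Pi.single j 1) i|) * (1 + ‖x‖) ^ 3 := by ring
    have := abs_mul_le_growth hb1 hb1
    refine integrable_mul_exp_neg_of_growth hAc ((contDiff_phi hA _).continuous.pow 2) hκ (by norm_num : 3 + 3 ≤ 8)
      hlb (D := (Kv + ∑ i, |H.mulVec (Pi.single j 1) i|) * (Kv + ∑ i, |H.mulVec (Pi.single j 1) i|))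
      (fun x => ?_)
    rw [sq]; exact this x
  obtain ⟨Cu, hCu0, hCu⟩ := exists_norm_affine_le H b
  have hn : (0:ℝ) ≤ n := Nat.cast_nonneg n
  have hIuuI : Integrable fun x => ((H.mulVec x + b) ⬝ᵥ (H.mulVec x + b)) * exp (-A x) := by
    refine integrable_mul_exp_neg_of_growth hAc (((contDiff_affine H b).continuous).dotProduct
      (contDiff_affine H b).continuous) hκ (by norm_num : 2 ≤ 8) hlb (D := (n : ℝ) * Cu ^ 2) fun x => ?_
    rw [abs_of_nonneg (by simpa using dotProduct_self_star_nonneg (H.mulVec x + b))]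
    have h3 : ‖H.mulVec x + b‖ ^ 2 ≤ Cu ^ 2 * (1 + ‖x‖) ^ 2 := by
      rw [← mul_pow]; exact pow_le_pow_left₀ (norm_nonneg _) (hCu x) 2
    nlinarith [dotProduct_self_le_card_mul_norm_sq (H.mulVec x + b), mul_le_mul_of_nonneg_left h3 hn]
  have hIS2 : Integrable fun x => (H.mulVec x ⬝ᵥ H.mulVec x) * exp (-A x) := by
    obtain ⟨CH, hCH0, hCH⟩ := exists_norm_affine_le H 0
    refine integrable_mul_exp_neg_of_growth hAc ((continuous_const.matrix_mulVec continuous_id).dotProduct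
      (continuous_const.matrix_mulVec continuous_id)) hκ (by norm_num : 2 ≤ 8) hlb (D := (n : ℝ) * CH ^ 2) fun x => ?_
    rw [abs_of_nonneg (by simpa using dotProduct_self_star_nonneg (H.mulVec x))]
    have h2 : ‖H.mulVec x‖ ≤ CH * (1 + ‖x‖) := by simpa using hCH x
    have h3 : ‖H.mulVec x‖ ^ 2 ≤ CH ^ 2 * (1 + ‖x‖) ^ 2 := by
      rw [← mul_pow]; exact pow_le_pow_left₀ (norm_nonneg _) h2 2
    nlinarith [dotProduct_self_le_card_mul_norm_sq (H.mulVec x), mul_le_mul_of_nonneg_left h3 hn]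
  have hIlin : ∀ w : Fin n → ℝ, Integrable fun x => (w ⬝ᵥ x) * exp (-A x) := fun w =>
    integrable_mul_exp_neg_of_growth hAc (continuous_const.dotProduct continuous_id) hκ
      (by norm_num : 1 ≤ 8) hlb (abs_dotProduct_le_growth w)
  have hlin0 : ∀ w : Fin n → ℝ, ∫ x, (w ⬝ᵥ x) * exp (-A x) = 0 :=
    integral_dotProduct_mul_exp_neg_eq_zero hAc hδ1 hsw hcent
  have hIuu : ∫ x, ((H.mulVec x + b) ⬝ᵥ (H.mulVec x + b)) * exp (-A x) =
      (∫ x, (H.mulVec x ⬝ᵥ H.mulVec x) * exp (-A x)) + (b ⬝ᵥ b) * Z := by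
    have e : (fun x => ((H.mulVec x + b) ⬝ᵥ (H.mulVec x + b)) * exp (-A x)) = fun x =>
        (H.mulVec x ⬝ᵥ H.mulVec x) * exp (-A x) + (((2:ℝ) • H.mulVec b) ⬝ᵥ x) * exp (-A x) +
          (b ⬝ᵥ b) * exp (-A x) := by
      funext x
      have e1 : H.mulVec x ⬝ᵥ b = H.mulVec b ⬝ᵥ x := by
        rw [← dotProduct_mulVec_of_isSymm hH x b, dotProduct_comm]
      have e2 : b ⬝ᵥ H.mulVec x = H.mulVec b ⬝ᵥ x := dotProduct_mulVec_of_isSymm hH b x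
      simp only [add_dotProduct, dotProduct_add, smul_dotProduct, smul_eq_mul, e1, e2]
      ring
    have hI1 : Integrable fun x => (H.mulVec x ⬝ᵥ H.mulVec x) * exp (-A x) +
        (((2:ℝ) • H.mulVec b) ⬝ᵥ x) * exp (-A x) := hIS2.add (hIlin _)
    rw [e, integral_add hI1 (hZint.const_mul _), integral_add hIS2 (hIlin _), integral_const_mul, hlin0]
    ring
  have hgradRI : Integrable fun x => (coordGradient R x ⬝ᵥ coordGradient R x) * exp (-A x) := by
    have hdomI : Integrable fun x => (2 * δ ^ 2) * (((H.mulVec x + b) ⬝ᵥ (H.mulVec x + b)) * exp (-A x)) +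
        2 * ∑ j, φ j x ^ 2 * exp (-A x) :=
      (hIuuI.const_mul _).add ((integrable_finsetSum _ fun j _ => hIφ2 j).const_mul 2)
    refine hdomI.mono' (((Literature.Probability.Distributions.continuous_coordGradient hRc1).dotProduct
      (Literature.Probability.Distributions.continuous_coordGradient hRc1)).mul
      (continuous_exp.comp hAc.neg)).aestronglyMeasurable (ae_of_all _ fun x => ?_)
    rw [Real.norm_eq_abs, abs_of_nonneg (mul_nonneg (by simpa using dotProduct_self_star_nonneg (coordGradient R x))
      (exp_pos _).le)]
    have h := mul_le_mul_of_nonneg_right (hgradR x) (exp_pos (-A x)).le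
    have e : (2 * (δ ^ 2 * ((H.mulVec x + b) ⬝ᵥ (H.mulVec x + b))) + 2 * ∑ j, φ j x ^ 2) * exp (-A x) =
        (2 * δ ^ 2) * (((H.mulVec x + b) ⬝ᵥ (H.mulVec x + b)) * exp (-A x)) + 2 * ∑ j, φ j x ^ 2 * exp (-A x) := by
      rw [add_mul, mul_assoc 2 (∑ j, φ j x ^ 2) (exp (-A x)), Finset.sum_mul]; ring
    linarith [h, e.le, e.ge]
  have hgradRint : ∫ x, (coordGradient R x ⬝ᵥ coordGradient R x) * exp (-A x) ≤
      2 * δ ^ 2 * ((∫ x, (H.mulVec x ⬝ᵥ H.mulVec x) * exp (-A x)) + (b ⬝ᵥ b) * Z) +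
        2 * ((1 - δ)⁻¹ * (δ ^ 2 * (H * H).trace) * Z) := by
    have hdomI : Integrable fun x => (2 * δ ^ 2) * (((H.mulVec x + b) ⬝ᵥ (H.mulVec x + b)) * exp (-A x)) +
        2 * ∑ j, φ j x ^ 2 * exp (-A x) :=
      (hIuuI.const_mul _).add ((integrable_finsetSum _ fun j _ => hIφ2 j).const_mul 2)
    have hmono : ∫ x, (coordGradient R x ⬝ᵥ coordGradient R x) * exp (-A x) ≤
        ∫ x, (2 * δ ^ 2) * (((H.mulVec x + b) ⬝ᵥ (H.mulVec x + b)) * exp (-A x)) +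
          2 * ∑ j, φ j x ^ 2 * exp (-A x) := by
      refine integral_mono hgradRI hdomI fun x => ?_
      have h := mul_le_mul_of_nonneg_right (hgradR x) (exp_pos (-A x)).le
      have e : (2 * (δ ^ 2 * ((H.mulVec x + b) ⬝ᵥ (H.mulVec x + b))) + 2 * ∑ j, φ j x ^ 2) * exp (-A x) =
          (2 * δ ^ 2) * (((H.mulVec x + b) ⬝ᵥ (H.mulVec x + b)) * exp (-A x)) + 2 * ∑ j, φ j x ^ 2 * exp (-A x) := by
        rw [add_mul, mul_assoc 2 (∑ j, φ j x ^ 2) (exp (-A x)), Finset.sum_mul]; ring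
      simpa only [e] using h
    have hIsum : Integrable fun x => ∑ j, φ j x ^ 2 * exp (-A x) := integrable_finsetSum _ fun j _ => hIφ2 j
    rw [integral_add (hIuuI.const_mul _) (hIsum.const_mul 2), integral_const_mul, integral_const_mul,
      integral_finsetSum _ (fun j _ => hIφ2 j), hIuu] at hmono
    have hsum : ∑ j, ∫ x, φ j x ^ 2 * exp (-A x) ≤ (1 - δ)⁻¹ * (δ ^ 2 * (H * H).trace) * Z := by
      calc ∑ j, ∫ x, φ j x ^ 2 * exp (-A x)
          ≤ ∑ j, (1 - δ)⁻¹ * (δ ^ 2 * (H.mulVec (Pi.single j 1) ⬝ᵥ H.mulVec (Pi.single j 1))) * Z :=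
            Finset.sum_le_sum fun j _ => hφ2 j
        _ = (1 - δ)⁻¹ * (δ ^ 2 * (H * H).trace) * Z := by
            rw [← hHcols, Finset.mul_sum, Finset.mul_sum, Finset.sum_mul]
    linarith
  have hinv : 0 ≤ (1 - δ)⁻¹ := inv_nonneg.mpr (by linarith)
  exact hblR.trans (mul_le_mul_of_nonneg_right (mul_le_mul_of_nonneg_left hgradRint hinv) hZ.le)

end Summit.QuantumFields.YangMills.Theorems.SandwichVariancePinching

end
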